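import Summits.Schanuel.Schanuel.Theorems.RootDecomp1BDefectFloorChannelsCells

/-!
# RootDecomp1BDefectFloorChannels — part 3 of 3 (lens-4 g10 NODE «Channels» = ROUND 10 of route-Schanuel-RootDecomp1B, a THEOREM ROUND;
# § Gen 10 of HOME/decomp-schanuel-lens-4/g10/Channels.lean (c3aeda0d…), `--supports stmt-Schanuel-32406`)

The floor SRL(r′ ∣ u) is a THREE-CHANNEL statement: ONE of the coordinate u / modulus e^u / phase e^{iu} of the last coordinate is
transcendental over the polar field F(r′) (`sharpRelativeLindemannAt_of_coordinate` / `_modulus` / `_phase_channel`). New decided cells with a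
DARK coordinate channel: the LW phase family (β ∣ γ + qπ) ∀ m and modulus family (β ∣ γ + log α) ∀ m (`algebraicIndependent_exp_holds`), the
Nesterenko cells (π ∣ log Γ(1/4)) and (π ∣ arctan Γ(1/4)) (mod `nesterenko`); channel certificates; the census theorem «rounds ≤ 9 were
coordinate-only». Extracted mechanically (dependency closure over the landed DefectFloor files: 64 § Gen 10 declarations + 11 earlier ones never
landed — `relDeg`, `polarDeg_eq_init_add_relDeg`, `sharpRelativeLindemannAt_iff_relDeg`, `one_le_relDeg_of_transcendental`, `init_piGamma`, …);
all parts share the namespace `Summit.Schanuel.Schanuel.Theorems.RootDecomp1BDefectFloorChannels`; twins of landed declarations are `open`ed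
(FedFlagCore / TameFlagCore / DefectFloorDefs / Core / Cells) or private copies; sorry-free; standard axioms.
-/

open Complex IntermediateField
open Literature.NumberTheory.Transcendental (trdeg_adjoin_le_of_le isAlgebraic_adjoin_over_algebraAdjoin nesterenko algebraicIndependent_exp_holds transcendental_pi_holds)

namespace Summit.Schanuel.Schanuel.Theorems.RootDecomp1BDefectFloorChannels

set_option linter.dupNamespace false

open Summit.Schanuel.Schanuel.Theorems.RootDecomp1BFedFlagCore
open Summit.Schanuel.Schanuel.Theorems.RootDecomp1BTameFlagCore
open Summit.Schanuel.Schanuel.Theorems.RootDecomp1BDefectFloorDefs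
open Summit.Schanuel.Schanuel.Theorems.RootDecomp1BDefectFloorCore
open Summit.Schanuel.Schanuel.Theorems.RootDecomp1BDefectFloorCells

section

variable {m : ℕ}

/-- (private copy; landed twin `Literature.NumberTheory.LFunctions.Real_Gamma_quarter_pos`) `Γ(1/4) > 0`. -/
private theorem Gamma_one_four_pos : 0 < Real.Gamma (1 / 4) := Real.Gamma_pos_of_pos (by norm_num)

/-- NESTERENKO makes Γ(1/4) TRANSCENDENTAL OVER F(π) = ℚ(π, iπ, e^π, −1): π, e^π ∈ F(π), `t(π) ≤ 2`, and π, e^π, Γ(1/4)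
are algebraically independent. -/
theorem transcendental_Gamma_over_polarField_pi (hN : nesterenko) :
    Transcendental ↥(polarField ![Real.pi]) ((Real.Gamma (1 / 4) : ℝ) : ℂ) := by
  intro hK
  have h3 : ((3 : ℕ) : Cardinal) ≤ polarDeg ![Real.pi] := by
    refine natCast_le_trdeg_of_isAlgebraic (polarField ![Real.pi])
      (algebraicIndependent_ofReal (algebraicIndependent_piExpPiGamma hN)) fun i => ?_
    fin_cases i
    · exact isAlgebraic_of_mem_subfield _ (coe_mem_polarField ![Real.pi] 0)
    · show IsAlgebraic _ ((piExpPiGamma 1 : ℝ) : ℂ)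
      have e1 : ((piExpPiGamma 1 : ℝ) : ℂ) = Complex.exp ((![Real.pi] 0 : ℝ) : ℂ) := by
        simp [piExpPiGamma, Complex.ofReal_exp]
      rw [e1]
      exact isAlgebraic_of_mem_subfield _ (exp_coe_mem_polarField ![Real.pi] 0)
    · exact hK
  have h := h3.trans polarDeg_pi_le_two
  norm_cast at h

/-- the same count, gen-9 census: Γ(1/4) as a COORDINATE of (π | Γ(1/4)) is transcendental over F(π) (coordinate channel). -/
theorem coordinate_transcendental_piGamma (hN : nesterenko) :
    Transcendental ↥(polarField (Fin.init piGamma)) ((piGamma 1 : ℝ) : ℂ) := by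
  rw [init_piGamma]
  exact transcendental_Gamma_over_polarField_pi hN

/-- (π, log Γ(1/4)) IS `ℚ`-free — DERIVED from Nesterenko: a rational relation `t·log Γ(1/4) = −s·π` (t ≠ 0) would give
`Γ(1/4) = e^{cπ}` with `c ∈ ℚ`, algebraic over F(π). (Nothing else is known about log Γ(1/4).) -/
theorem linearIndependent_piLogGamma (hN : nesterenko) : LinearIndependent ℚ piLogGamma := by
  show LinearIndependent ℚ ![Real.pi, Real.log (Real.Gamma (1 / 4))]
  refine LinearIndependent.pair_iff.mpr fun s t hst => ?_
  by_contra hne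
  rw [Rat.smul_def, Rat.smul_def] at hst
  have ht : t ≠ 0 := by
    intro ht
    apply hne
    rw [ht, Rat.cast_zero, zero_mul, add_zero] at hst
    have hs : (s : ℝ) = 0 := (mul_eq_zero.mp hst).resolve_right Real.pi_ne_zero
    exact ⟨by exact_mod_cast hs, ht⟩
  have ht' : ((t : ℚ) : ℝ) ≠ 0 := by exact_mod_cast ht
  set c : ℚ := -s / t with hc
  have hL : Real.log (Real.Gamma (1 / 4)) = ((c : ℚ) : ℝ) * Real.pi := by
    rw [hc]
    push_cast
    rw [div_mul_eq_mul_div, eq_div_iff ht']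
    linear_combination hst
  apply transcendental_Gamma_over_polarField_pi hN
  have e : ((Real.Gamma (1 / 4) : ℝ) : ℂ) = Complex.exp ((((c : ℝ) * Real.pi : ℝ)) : ℂ) := by
    rw [← Complex.ofReal_exp, ← hL, Real.exp_log Gamma_one_four_pos]
  rw [e]
  exact isAlgebraic_exp_rat_mul_pi c

/-- NESTERENKO DECIDES THE FLOOR AT (π | log Γ(1/4)) THROUGH THE MODULUS: `t(π, log Γ(1/4)) ≥ 3` — π, e^π and
`e^u = Γ(1/4)` lie in F(π, log Γ(1/4)) and are algebraically independent; the coordinate log Γ(1/4) itself is DARK. -/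
theorem three_le_polarDeg_piLogGamma (hN : nesterenko) : ((3 : ℕ) : Cardinal) ≤ polarDeg piLogGamma := by
  have h := algebraicIndependent_ofReal (algebraicIndependent_piExpPiGamma hN)
  refine natCast_le_trdeg_of_algebraicIndependent h fun i => ?_
  fin_cases i
  · exact coe_mem_polarField piLogGamma 0
  · show ((piExpPiGamma 1 : ℝ) : ℂ) ∈ polarField piLogGamma
    have e1 : ((piExpPiGamma 1 : ℝ) : ℂ) = Complex.exp ((piLogGamma 0 : ℝ) : ℂ) := by
      simp [piExpPiGamma, piLogGamma, Complex.ofReal_exp]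
    rw [e1]
    exact exp_coe_mem_polarField piLogGamma 0
  · show ((piExpPiGamma 2 : ℝ) : ℂ) ∈ polarField piLogGamma
    have e2 : ((piExpPiGamma 2 : ℝ) : ℂ) = Complex.exp ((piLogGamma 1 : ℝ) : ℂ) := by
      rw [exp_piLogGamma_one]
      rfl
    rw [e2]
    exact exp_coe_mem_polarField piLogGamma 1

/-- THE CELL `SharpRelativeLindemannAt 1 (π | log Γ(1/4))` IS A THEOREM (given Nesterenko) … -/
theorem sharpRelativeLindemannAt_piLogGamma (hN : nesterenko) : SharpRelativeLindemannAt 1 piLogGamma :=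
  fun _ _ _ => by exact_mod_cast three_le_polarDeg_piLogGamma hN

/-- … with both structural hypotheses discharged ((π) sharp, the pair `ℚ`-free).  X at (π, log Γ(1/4)) — FOUR
algebraically independent among π, e^π, Γ(1/4), log Γ(1/4), Γ(1/4)^i — is OPEN. -/
theorem piLogGamma_cell_hypotheses (hN : nesterenko) :
    LinearIndependent ℚ piLogGamma ∧ polarDeg (Fin.init piLogGamma) ≤ ((1 + 1 : ℕ) : Cardinal) :=
  ⟨linearIndependent_piLogGamma hN, by rw [init_piLogGamma]; exact_mod_cast polarDeg_pi_le_two⟩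

/-- the MODULUS channel of (π | log Γ(1/4)) is certified open. -/
theorem modulus_transcendental_piLogGamma (hN : nesterenko) :
    Transcendental ↥(polarField (Fin.init piLogGamma)) (Complex.exp ((piLogGamma 1 : ℝ) : ℂ)) := by
  rw [init_piLogGamma, exp_piLogGamma_one]
  exact transcendental_Gamma_over_polarField_pi hN

/-- Γ(1/4) ∈ F(π, arctan Γ(1/4)) — through the PHASE `e^{iu}` (and `i = (iπ)/π ∈ F`): `Γ(1/4) = tan u`. -/
theorem Gamma_mem_polarField_piArctanGamma : ((Real.Gamma (1 / 4) : ℝ) : ℂ) ∈ polarField piArctanGamma := by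
  rw [← tan_piArctanGamma_one]
  exact tan_mem_of_exp_mul_I_mem _ (exp_coe_mul_I_mem_polarField piArctanGamma 1)
    (I_mem_polarField piArctanGamma 0 Real.pi_ne_zero)

/-- (π, arctan Γ(1/4)) IS `ℚ`-free — DERIVED from Nesterenko: a rational relation would give `Γ(1/4) = tan(cπ)`, `c ∈ ℚ`,
an ALGEBRAIC number. -/
theorem linearIndependent_piArctanGamma (hN : nesterenko) : LinearIndependent ℚ piArctanGamma := by
  show LinearIndependent ℚ ![Real.pi, Real.arctan (Real.Gamma (1 / 4))]
  refine LinearIndependent.pair_iff.mpr fun s t hst => ?_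
  by_contra hne
  rw [Rat.smul_def, Rat.smul_def] at hst
  have ht : t ≠ 0 := by
    intro ht
    apply hne
    rw [ht, Rat.cast_zero, zero_mul, add_zero] at hst
    have hs : (s : ℝ) = 0 := (mul_eq_zero.mp hst).resolve_right Real.pi_ne_zero
    exact ⟨by exact_mod_cast hs, ht⟩
  have ht' : ((t : ℚ) : ℝ) ≠ 0 := by exact_mod_cast ht
  set c : ℚ := -s / t with hc
  have hL : Real.arctan (Real.Gamma (1 / 4)) = ((c : ℚ) : ℝ) * Real.pi := by
    rw [hc]
    push_cast
    rw [div_mul_eq_mul_div, eq_div_iff ht']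
    linear_combination hst
  apply transcendental_Gamma_over_polarField_pi hN
  have e : ((Real.Gamma (1 / 4) : ℝ) : ℂ) = Complex.tan ((((c : ℝ) * Real.pi : ℝ)) : ℂ) := by
    rw [← Complex.ofReal_tan, ← hL, Real.tan_arctan]
  rw [e]
  exact (isAlgebraic_tan_rat_mul_pi c).tower_top _

/-- NESTERENKO DECIDES THE FLOOR AT (π | arctan Γ(1/4)) THROUGH THE PHASE: `t(π, arctan Γ(1/4)) ≥ 3` — π, e^π ∈ F and
`Γ(1/4) = tan u ∈ ℚ(i, e^{iu}) ⊂ F`; the coordinate arctan Γ(1/4) itself is DARK. -/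
theorem three_le_polarDeg_piArctanGamma (hN : nesterenko) : ((3 : ℕ) : Cardinal) ≤ polarDeg piArctanGamma := by
  have h := algebraicIndependent_ofReal (algebraicIndependent_piExpPiGamma hN)
  refine natCast_le_trdeg_of_algebraicIndependent h fun i => ?_
  fin_cases i
  · exact coe_mem_polarField piArctanGamma 0
  · show ((piExpPiGamma 1 : ℝ) : ℂ) ∈ polarField piArctanGamma
    have e1 : ((piExpPiGamma 1 : ℝ) : ℂ) = Complex.exp ((piArctanGamma 0 : ℝ) : ℂ) := by
      simp [piExpPiGamma, piArctanGamma, Complex.ofReal_exp]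
    rw [e1]
    exact exp_coe_mem_polarField piArctanGamma 0
  · exact Gamma_mem_polarField_piArctanGamma

/-- THE CELL `SharpRelativeLindemannAt 1 (π | arctan Γ(1/4))` IS A THEOREM (given Nesterenko) … -/
theorem sharpRelativeLindemannAt_piArctanGamma (hN : nesterenko) : SharpRelativeLindemannAt 1 piArctanGamma :=
  fun _ _ _ => by exact_mod_cast three_le_polarDeg_piArctanGamma hN

/-- … with both structural hypotheses discharged.  X at (π, arctan Γ(1/4)) is OPEN. -/
theorem piArctanGamma_cell_hypotheses (hN : nesterenko) :
    LinearIndependent ℚ piArctanGamma ∧ polarDeg (Fin.init piArctanGamma) ≤ ((1 + 1 : ℕ) : Cardinal) :=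
  ⟨linearIndependent_piArctanGamma hN, by rw [init_piArctanGamma]; exact_mod_cast polarDeg_pi_le_two⟩

/-- the PHASE channel of (π | arctan Γ(1/4)) is certified open: `e^{i arctan Γ(1/4)} = (1 + iΓ(1/4))/√(1 + Γ(1/4)²)` is
transcendental over F(π) (else `tan u = Γ(1/4)` would be algebraic over F(π) ∋ i). -/
theorem phase_transcendental_piArctanGamma (hN : nesterenko) :
    Transcendental ↥(polarField (Fin.init piArctanGamma))
      (Complex.exp (((piArctanGamma 1 : ℝ) : ℂ) * Complex.I)) := by
  rw [init_piArctanGamma]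
  intro hE
  apply transcendental_Gamma_over_polarField_pi hN
  rw [← tan_piArctanGamma_one]
  have hI : Complex.I ∈ algebraicClosure (↥(polarField ![Real.pi])) ℂ :=
    mem_algebraicClosure_iff.mpr (isAlgebraic_of_mem_subfield _ (I_mem_polarField ![Real.pi] 0 Real.pi_ne_zero))
  exact mem_algebraicClosure_iff.mp
    (tan_mem_of_exp_mul_I_mem (algebraicClosure (↥(polarField ![Real.pi])) ℂ) (mem_algebraicClosure_iff.mpr hE) hI)

/-- GEN-10 SURFACE, packaged: the floor is DECIDED, with all structural hypotheses discharged, on (i) every rational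
rotation (β | γ + qπ) and (ii) every logarithmic shift (β | γ + log α) of the Lindemann–Weierstrass hyperplane, at every
length, and (iii)/(iv) — given Nesterenko — at (π | log Γ(1/4)) and (π | arctan Γ(1/4)); in each the decision goes
through `e^u` or `e^{iu}`, never through `u`. -/
theorem channel_cells :
    (∀ (m : ℕ) (β : Fin m → ℝ) (γ : ℝ) (q : ℚ), (∀ j, IsAlgebraic ℚ ((β j : ℝ) : ℂ)) → IsAlgebraic ℚ ((γ : ℝ) : ℂ) →
        LinearIndependent ℚ (Fin.snoc β γ : Fin (m + 1) → ℝ) →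
        SharpRelativeLindemannAt m (Fin.snoc β (γ + q * Real.pi) : Fin (m + 1) → ℝ) ∧
          LinearIndependent ℚ (Fin.snoc β (γ + q * Real.pi) : Fin (m + 1) → ℝ) ∧
          polarDeg (Fin.init (Fin.snoc β (γ + q * Real.pi) : Fin (m + 1) → ℝ)) ≤ ((m + m : ℕ) : Cardinal)) ∧
    (∀ (m : ℕ) (β : Fin m → ℝ) (γ α : ℝ), (∀ j, IsAlgebraic ℚ ((β j : ℝ) : ℂ)) → IsAlgebraic ℚ ((γ : ℝ) : ℂ) →
        IsAlgebraic ℚ ((α : ℝ) : ℂ) → 0 < α → LinearIndependent ℚ (Fin.snoc β γ : Fin (m + 1) → ℝ) →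
        SharpRelativeLindemannAt m (Fin.snoc β (γ + Real.log α) : Fin (m + 1) → ℝ) ∧
          LinearIndependent ℚ (Fin.snoc β (γ + Real.log α) : Fin (m + 1) → ℝ) ∧
          polarDeg (Fin.init (Fin.snoc β (γ + Real.log α) : Fin (m + 1) → ℝ)) ≤ ((m + m : ℕ) : Cardinal)) ∧
    (nesterenko → (SharpRelativeLindemannAt 1 piLogGamma ∧ LinearIndependent ℚ piLogGamma ∧
        polarDeg (Fin.init piLogGamma) ≤ ((1 + 1 : ℕ) : Cardinal)) ∧
      (SharpRelativeLindemannAt 1 piArctanGamma ∧ LinearIndependent ℚ piArctanGamma ∧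
        polarDeg (Fin.init piArctanGamma) ≤ ((1 + 1 : ℕ) : Cardinal))) :=
  ⟨fun _ β γ q hβ hγ hli => ⟨sharpRelativeLindemannAt_snoc_phaseShift β γ q hβ hγ hli,
      phaseShift_cell_hypotheses β γ q hβ hγ hli⟩,
    fun _ β γ α hβ hγ hα hα0 hli => ⟨sharpRelativeLindemannAt_snoc_logShift β γ α hβ hγ hα hα0 hli,
      logShift_cell_hypotheses β γ α hβ hγ hα hα0 hli⟩,
    fun hN => ⟨⟨sharpRelativeLindemannAt_piLogGamma hN, piLogGamma_cell_hypotheses hN⟩,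
      ⟨sharpRelativeLindemannAt_piArctanGamma hN, piArctanGamma_cell_hypotheses hN⟩⟩⟩






end

end Summit.Schanuel.Schanuel.Theorems.RootDecomp1BDefectFloorChannels
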